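import Summits.QuantumAdvantage.QuantumAdvantage.Theorems.HankelLiftBeyondRectangles
import Literature.Computability.Complexity.PairingMachines
import Literature.Computability.Complexity.CodeFPStrings
import HarnessLib

/-!
# Route HankelLift, crux `BeyondRectangles` (stmt-QuantumAdvantage-18440): the UNIFORM-law form of the
# residual hypothesis

`HankelLiftBeyondRectangles.lean` (p559743) reduces the hypothesis-type crux `HankelLift.BeyondRectangles` — and
with the route's theorems the summit — to `LiouvilleBPPDark` (`HankelLiftBeyondRectanglesDefs.lean`): no PPT
`1/6`-correlates with `λ(m+2)` under the TRIANGULAR law `rₙ(m)/4ⁿ` of `m = x + y` (`x, y` uniform `n`-bit),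
infinitely often.  The triangular weight is an artefact of the route's sum-lift.  This file removes it:

* `uniformCorr B n = Σ_{m<2ⁿ⁺¹} λ(m+2)·(2·Pr[B(encSum n m) = true] − 1)` — the correlation of a single-integer
  predictor with `λ(m+2)` for `m` UNIFORM on `(n+1)`-bit integers;
* `UniformLiouvilleBPPDark : Prop` — for every PPT `B`, `|uniformCorr B n| ≤ 2ⁿ⁺¹/12` for infinitely many `n`
  (correlation `≤ 1/12` under the uniform law): the randomized, average-case, infinitely-often form of Pudlák's
  "λ is pseudorandom against P" (bib: Pudlak2013Pseudorandomness, Def. 2, which asks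
  `(1/N) Σ_{m<N} f(m)λ(m) → 0` for every deterministic polynomial-time `f : ℕ → {±1}`);
* `reweight B` — the REWEIGHTING gadget (a `RandAlg`): on input `w` (`n = |w| − 1`, `m = val w`), with coins
  `c = u ++ b :: r` (`|u| = n`), run `B(w; r)` if `val(u) < rₙ(m)` and otherwise output the coin `b`; so
  `2·Pr[reweight B (m) = true] − 1 = (rₙ(m)/2ⁿ)·(2·Pr[B(m) = true] − 1)` (`two_mul_pr_reweight_sub_one`) and
  `uniformCorr (reweight B) n = sumCorr B n / 2ⁿ` (`uniformCorr_reweight`); it is PPT when `B` is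
  (`reweight_isPolyTime`: the bridge `codeFP_uncurry_run` from `RandAlg.IsPolyTime` to the `CodeFP` algebra via the
  re-pairing machine `polyTimeComputable_boolUnpair`, then `CodeFP.ite`);
* `liouvilleBPPDark_of_uniform : UniformLiouvilleBPPDark → LiouvilleBPPDark`, hence
  `beyondRectangles_of_uniformLiouvilleBPPDark`, `quantumAdvantage_of_uniformLiouvilleBPPDark`.

WHAT THIS IS NOT: `UniformLiouvilleBPPDark` is OPEN (hypothesis-type; it implies the summit with the route's theorems,
so `Literature.Barriers.QuantumAdvantage.SeparationPrerequisites` applies to it exactly as to the crux); nothing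
unconditional about `BPP` is claimed; separation NOT moved.
-/

-- the sub-problem namespace `Summit.QuantumAdvantage.QuantumAdvantage` repeats the summit name by design (D-0017)
set_option linter.dupNamespace false

noncomputable section

namespace Summit.QuantumAdvantage.QuantumAdvantage.Theorems.BeyondRectangles

open scoped BigOperators Classical
open Literature.Computability.Complexity Literature.Computability.Complexity.CodeFP
open _root_.Computability (encodeBool)
open Summit.QuantumAdvantage.QuantumAdvantage.Theses.HankelLift (BeyondRectangles)

/-! ### The uniform-law correlation and the hypothesis -/

/-- UNIFORM-law correlation of a single-integer predictor `B` with the shifted Liouville function at level `n`: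
`uniformCorr B n = Σ_{m < 2ⁿ⁺¹} λ(m + 2)·(2·Pr[B(encSum n m) = true] − 1) ∈ [−2ⁿ⁺¹, 2ⁿ⁺¹]`.
[cite: BogdanovTrevisan2006, Def. 2.13] -/
def uniformCorr (B : RandAlg (List Bool) Bool) (n : ℕ) : ℝ :=
  ∑ m ∈ Finset.range (2 ^ (n + 1)),
    ((ArithmeticFunction.liouville (m + 2) : ℤ) : ℝ) * (2 * B.pr id (encSum n m) {true} - 1)

/-- **`UniformLiouvilleBPPDark`** — Liouville is dark against BPP observables under the UNIFORM law on `(n+1)`-bit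
integers, with constant correlation `1/12`, infinitely often: for every probabilistic polynomial-time `B`,
`|uniformCorr B n| ≤ 2ⁿ⁺¹/12` for infinitely many `n`.  The randomized, average-case, i.o. form of Pudlák's
"λ is pseudorandom against P" (bib: Pudlak2013Pseudorandomness, Definition 2 and §2.3: proved for AC⁰-type classes
only — Green 2012 —, implies that integers cannot be factored in polynomial time).  A ROUTE-POSITED OPEN HYPOTHESIS
(deliberately no cite tag): it implies `LiouvilleBPPDark` (`liouvilleBPPDark_of_uniform`), hence the crux and,
with the route's theorems, the summit. -/
def UniformLiouvilleBPPDark : Prop :=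
  ∀ B : RandAlg (List Bool) Bool, B.IsPolyTime id Computability.encodeBool →
    ∃ᶠ n : ℕ in Filter.atTop, |uniformCorr B n| ≤ (2 : ℝ) ^ (n + 1) / 12

/-! ### The reweighting gadget -/

/-- **The reweighting gadget** `reweight B`: on input `w` (`n = |w| − 1`, `m = val w`) with coins `c`, read the block
`u = c ↾ n`; if `val(u) < rₙ(m)` (`= adLen n m`) run `B` on `w` with the coins `c ⇂ (n+1)`, otherwise output the coin
`c[n]`.  Coin budget `L + coinLen_B(L)`. [cite: AroraBarak2009, §7.1] -/
def reweight (B : RandAlg (List Bool) Bool) : RandAlg (List Bool) Bool where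
  run w c :=
    if bitsToNat (c.take (w.length - 1)) < adLen (w.length - 1) (bitsToNat w) then B.run w (c.drop w.length)
    else c.getD (w.length - 1) false
  coinLen L := L + B.coinLen L

/-- **From `RandAlg.IsPolyTime` to the `CodeFP` algebra**: the run map of a PPT Boolean algorithm, as a map on coded
pairs, is computed on codes by a polynomial-time string function (precompose the re-pairing machine
`polyTimeComputable_boolUnpair`, `PolyTimeComputable.comp_holds`). [cite: AroraBarak2009, §1.3] -/
theorem codeFP_uncurry_run {B : RandAlg (List Bool) Bool} (hB : B.IsPolyTime id encodeBool) :
    CodeFP (pairE strE strE) bitE (Function.uncurry B.run) := by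
  have h := PolyTimeComputable.comp_holds hB.1 polyTimeComputable_boolUnpair
  obtain ⟨p, M, hM⟩ := h
  refine CodeFP.of_fn (fun s => [Function.uncurry B.run (boolUnpair s)]) ⟨p, M, fun s => hM s⟩ fun q => ?_
  simp [Function.uncurry, bitE]

/-- **The reweighting gadget is PPT** whenever `B` is: a `CodeFP.ite` on the computed bit `[val(c ↾ n) < rₙ(m)]`
between `B`'s run on `(w, c ⇂ (n+1))` and the coin `c[n]`; coin budget `X + p_B`. [cite: AroraBarak2009, §7.1] -/
theorem reweight_isPolyTime {B : RandAlg (List Bool) Bool} (hB : B.IsPolyTime id encodeBool) :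
    (reweight B).IsPolyTime id encodeBool := by
  refine ⟨?_, ?_⟩
  · have hcond : CodeFP (pairE strE strE) bitE (fun q : List Bool × List Bool =>
        decide (bitsToNat (q.2.take (q.1.length - 1)) < adLen (q.1.length - 1) (bitsToNat q.1))) :=
      natLt.comp ((strVal.comp (strTake.comp ((codeFP_level.comp (fst _ _)).pair (snd _ _)))).pair
        (codeFP_adLen.comp (fst _ _)))
    have hthen : CodeFP (pairE strE strE) bitE (fun q : List Bool × List Bool => B.run q.1 (q.2.drop q.1.length)) :=
      ((codeFP_uncurry_run hB).comp ((fst _ _).pair (strDrop.comp ((strLength.comp (fst _ _)).pair (snd _ _))))).congr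
        fun _ => rfl
    have helse : CodeFP (pairE strE strE) bitE (fun q : List Bool × List Bool => q.2.getD (q.1.length - 1) false) :=
      strGetD.comp ((codeFP_level.comp (fst _ _)).pair (snd _ _))
    have h := (hcond.ite hthen helse).polyTimeComputable
    obtain ⟨p, M, hM⟩ := h
    refine ⟨p, M, fun q => ?_⟩
    have e : (fun q : List Bool × List Bool =>
        if decide (bitsToNat (q.2.take (q.1.length - 1)) < adLen (q.1.length - 1) (bitsToNat q.1)) = true then
          B.run q.1 (q.2.drop q.1.length) else q.2.getD (q.1.length - 1) false) q =
        Function.uncurry (reweight B).run q := by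
      simp only [reweight, Function.uncurry, decide_eq_true_eq]
    have := hM q
    rw [e] at this
    exact this
  · obtain ⟨p, hp⟩ := hB.2
    refine ⟨Polynomial.X + p, fun L => ?_⟩
    simp only [reweight, Polynomial.eval_add, Polynomial.eval_X]
    have := hp L
    omega

/-! ### The law of the gadget -/

/-- One coin in front: `cnt (a+1) {v | Q (v ⇂ 1)} = 2·cnt a Q` and `cnt (a+1) {v | v[0]} = 2^a`. [folklore] -/
theorem uniformProb_succ_drop_one (a : ℕ) (Q : Set (List Bool)) :
    uniformProb (a + 1) {v | v.drop 1 ∈ Q} = uniformProb a Q := by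
  rw [uniformProb_eq_cnt_div, uniformProb_eq_cnt_div, cnt_succ, pow_succ]
  have h1 : {y : List Bool | false :: y ∈ {v : List Bool | v.drop 1 ∈ Q}} = Q := by ext y; simp
  have h2 : {y : List Bool | true :: y ∈ {v : List Bool | v.drop 1 ∈ Q}} = Q := by ext y; simp
  rw [h1, h2]
  push_cast
  field_simp
  ring

/-- One coin in front, read: `Pr_{a+1}[v[0] = 1] = 1/2`. [folklore] -/
theorem uniformProb_succ_getD_zero (a : ℕ) :
    uniformProb (a + 1) {v : List Bool | v.getD 0 false = true} = 1 / 2 := by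
  rw [uniformProb_eq_cnt_div, cnt_succ, pow_succ]
  have h1 : {y : List Bool | false :: y ∈ {v : List Bool | v.getD 0 false = true}} = ∅ := by ext y; simp
  have h2 : {y : List Bool | true :: y ∈ {v : List Bool | v.getD 0 false = true}} = Set.univ := by ext y; simp
  rw [h1, h2, cnt_univ]
  have h0 : cnt a ∅ = 0 := by
    have := cnt_add_cnt_compl a (∅ : Set (List Bool))
    rw [Set.compl_empty, cnt_univ] at this
    omega
  rw [h0, Nat.zero_add]
  push_cast
  field_simp

/-- **The law of the gadget**: for `|w| = n + 1`,
`Pr[reweight B (w) = true] = (R·Pr[B(w) = true] + (2ⁿ − R)/2) / 2ⁿ` with `R = adLen n (val w) ≤ 2ⁿ`, i.e.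
`2·Pr[reweight B (w) = true] − 1 = (R / 2ⁿ)·(2·Pr[B(w) = true] − 1)`. [cite: AroraBarak2009, §7.1] -/
theorem two_mul_pr_reweight_sub_one (B : RandAlg (List Bool) Bool) {n : ℕ} {w : List Bool} (hw : w.length = n + 1) :
    2 * (reweight B).pr id w {true} - 1 =
      (adLen n (bitsToNat w) : ℝ) / 2 ^ n * (2 * B.pr id w {true} - 1) := by
  set R := adLen n (bitsToNat w) with hR
  set P := B.pr id w {true} with hP
  have hRle : R ≤ 2 ^ n := adLen_le n _
  -- conditioning on the block `u`
  have hcl : (reweight B).coinLen (id w).length = n + (B.coinLen (n + 1) + 1) := by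
    simp only [reweight, id, hw]; ring
  have hPr : (reweight B).pr id w {true} =
      (∑ c ∈ Finset.range (2 ^ n), if c < R then P else 1 / 2) / 2 ^ n := by
    rw [RandAlg.pr_eq_uniformProb, hcl, uniformProb_prefix,
      ← sum_vector_bitsToNat n (fun c => if c < R then P else 1 / 2)]
    congr 1
    refine Finset.sum_congr rfl fun u _ => ?_
    have hu : u.toList.length = n := u.toList_length
    -- the run on `u ++ v`
    have hrun : ∀ v : List Bool, (reweight B).run w (u.toList ++ v) =
        if bitsToNat u.toList < R then B.run w (v.drop 1) else v.getD 0 false := by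
      intro v
      simp only [reweight, hw, Nat.add_sub_cancel]
      rw [List.take_left' hu, List.drop_append, List.drop_eq_nil_of_le (by omega), List.nil_append, hu,
        show n + 1 - n = 1 by omega, List.getD_append_right _ _ _ _ (le_of_eq hu), hu, Nat.sub_self]
    by_cases hc : bitsToNat u.toList < R
    · rw [if_pos hc]
      have hset : {v : List Bool | u.toList ++ v ∈ {c : List Bool | (reweight B).run w c ∈ ({true} : Set Bool)}} =
          {v : List Bool | v.drop 1 ∈ {y : List Bool | B.run w y ∈ ({true} : Set Bool)}} := by
        ext v
        simp only [Set.mem_setOf_eq, hrun v, if_pos hc]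
      rw [hset, uniformProb_succ_drop_one, hP, RandAlg.pr_eq_uniformProb]
      simp [hw]
    · rw [if_neg hc]
      have hset : {v : List Bool | u.toList ++ v ∈ {c : List Bool | (reweight B).run w c ∈ ({true} : Set Bool)}} =
          {v : List Bool | v.getD 0 false = true} := by
        ext v
        simp only [Set.mem_setOf_eq, hrun v, if_neg hc, Set.mem_singleton_iff]
      rw [hset, uniformProb_succ_getD_zero]
  -- evaluate the sum: `R` copies of `P` and `2ⁿ − R` halves
  have hsum : ∑ c ∈ Finset.range (2 ^ n), (if c < R then P else 1 / 2) = R * P + ((2 : ℝ) ^ n - R) / 2 := by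
    have hsplit : 2 ^ n = R + (2 ^ n - R) := by omega
    rw [hsplit, Finset.sum_range_add]
    have h1 : ∑ c ∈ Finset.range R, (if c < R then P else 1 / 2) = R * P := by
      rw [Finset.sum_congr rfl fun c hc => if_pos (Finset.mem_range.1 hc), Finset.sum_const, Finset.card_range,
        nsmul_eq_mul]
    have h2 : ∑ c ∈ Finset.range (2 ^ n - R), (if R + c < R then P else 1 / 2) = ((2 : ℝ) ^ n - R) / 2 := by
      rw [Finset.sum_congr rfl fun c _ => if_neg (by omega), Finset.sum_const, Finset.card_range, nsmul_eq_mul]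
      have : ((2 ^ n - R : ℕ) : ℝ) = (2 : ℝ) ^ n - R := by
        rw [Nat.cast_sub hRle]; push_cast; ring
      rw [this]; ring
    rw [h1, h2]
  rw [hPr, hsum]
  have h2n : (0 : ℝ) < 2 ^ n := by positivity
  field_simp
  ring

/-- **`uniformCorr (reweight B) n = sumCorr B n / 2ⁿ`.** [folklore] -/
theorem uniformCorr_reweight (B : RandAlg (List Bool) Bool) (n : ℕ) :
    uniformCorr (reweight B) n = sumCorr B n / 2 ^ n := by
  unfold uniformCorr sumCorr
  rw [Finset.sum_div]
  refine Finset.sum_congr rfl fun m hm => ?_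
  rw [Finset.mem_range] at hm
  rw [two_mul_pr_reweight_sub_one B (length_encSum n m), bitsToNat_encSum hm, antidiag_eq_adLen]
  ring

/-! ### The uniform law suffices -/

/-- **`UniformLiouvilleBPPDark → LiouvilleBPPDark`**: apply uniform-law darkness to the reweighting gadget
`reweight B` (PPT by `reweight_isPolyTime`) and multiply by `2ⁿ`:
`|sumCorr B n| = 2ⁿ·|uniformCorr (reweight B) n| ≤ 2ⁿ·2ⁿ⁺¹/12 = 4ⁿ/6`. [cite: AroraBarak2009, §7.1] -/
theorem liouvilleBPPDark_of_uniform (h : UniformLiouvilleBPPDark) : LiouvilleBPPDark := by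
  intro B hB
  refine (h (reweight B) (reweight_isPolyTime hB)).mono fun n hn => ?_
  rw [uniformCorr_reweight, abs_div, abs_of_pos (by positivity : (0 : ℝ) < 2 ^ n),
    div_le_iff₀ (by positivity : (0 : ℝ) < 2 ^ n)] at hn
  have h4 : (4 : ℝ) ^ n = 2 ^ n * 2 ^ n := by rw [← mul_pow]; norm_num
  rw [h4]
  calc |sumCorr B n| ≤ (2 : ℝ) ^ (n + 1) / 12 * 2 ^ n := hn
    _ = 2 ^ n * 2 ^ n / 6 := by rw [pow_succ]; ring

/-- **The crux from uniform-law Liouville darkness.** [cite: BogdanovTrevisan2006, Def. 2.13] -/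
theorem beyondRectangles_of_uniformLiouvilleBPPDark (h : UniformLiouvilleBPPDark) : BeyondRectangles :=
  beyondRectangles_of_liouvilleBPPDark (liouvilleBPPDark_of_uniform h)

/-- **The summit from uniform-law Liouville darkness** (CONDITIONAL on the open hypothesis
`UniformLiouvilleBPPDark`; nothing unconditional about `BPP` is claimed). [cite: AroraBarak2009, Thm. 7.10] -/
theorem quantumAdvantage_of_uniformLiouvilleBPPDark (h : UniformLiouvilleBPPDark) : QuantumAdvantage :=
  quantumAdvantage_of_liouvilleBPPDark (liouvilleBPPDark_of_uniform h)

end Summit.QuantumAdvantage.QuantumAdvantage.Theorems.BeyondRectangles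

end
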